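import Literature.Computability.Complexity.ClockedUniversalSimulationProofs
import Literature.Computability.Complexity.PlumbingBricks
import HarnessLib

/-!
# Deciding a timed language in polynomial time GIVEN A UNARY BUDGET (downward translation on a pad)

Trunk `CplxCore` toolkit. The tree translates UPWARD (`ExpPadding.lean`: a polynomial-time decider
of the padded language gives `L ∈ EXP`); machines written in the `FP` brick algebra on exponentially
padded inputs (`MetaComplexity/UHSMachine.lean`, `UniformDerandomizationMachine.lean`,
`NWGeneratorMachine.lean`) need the DOWNWARD direction — to evaluate a language of high
deterministic time complexity INSIDE a polynomial-time brick, on the strength of a long enough pad.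
This is Arora–Barak's universal machine with a time bound (Thm. 1.9, §1.4.1: "a variant of `𝒰` that
gets a number `T` as an extra input … and outputs `M_α(x)` iff `M_α` halts on `x` within `T` steps"),
available in the tree as the clocked interpreter `ClockedUS.run` / the string function
`ClockedUS.Ufn ∈ FP` (`ClockedUniversalSimulationProofs.lean`):

* `budgetDecideF e` — the brick `⟨u, x⟩ ↦ tail (Ufn ⟨⟨e, x⟩, 1^{|u|}⟩)`: run the machine coded by
  `e` on `x` with budget `|u|` and strip the `optionBool` tag (`budgetDecideF_mem_FP`,
  `budgetDecideF_apply`);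
* **`exists_FP_decide_of_budget`** — for `L ∈ DTIME T` there are `F ∈ FP`, a constant `c` and an
  overhead polynomial `p` such that `F ⟨u, x⟩ = [x ∈ L]` whenever `|u| ≥ p(c · T(|x|) + c)` (any
  longer budget is fine: `ClockedUS.run_mono`).

## References

* S. Arora, B. Barak, *Computational Complexity: A Modern Approach*, CUP 2009, Thm. 1.9 and §1.4.1
  (universal TM with a time bound), §2.6.2 (padding) [AroraBarakCC2009].
-/

noncomputable section

namespace Literature.Computability.Complexity

open _root_.Computability Polynomial Brick Plumb

/-! ### The brick -/

/-- **Deciding with a unary budget**: `⟨u, x⟩ ↦ tail (Ufn ⟨⟨e, x⟩, 1^{|u|}⟩)` — the clocked universal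
machine run on the code word `e` and input `x` with budget `|u|`, the leading `optionBool` tag dropped
(`dropFn` by one). [cite: AroraBarakCC2009, Thm. 1.9 and §1.4.1] -/
def budgetDecideF (e : List Bool) : List Bool → List Bool :=
  dropFn ∘ fanoutFn (fun _ => [true]) (ClockedUS.Ufn ∘ fanoutFn (fanoutFn (fun _ => e) sndF) (onesFn ∘ fstF))

/-- `budgetDecideF e ∈ FP`. [cite: AroraBarakCC2009, Thm. 1.9] -/
theorem budgetDecideF_mem_FP (e : List Bool) : budgetDecideF e ∈ FP :=
  comp_mem_FP dropFn_mem_FP (fanoutFn_mem_FP (const_mem_FP _)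
    (comp_mem_FP ClockedUS.Ufn_mem_FP
      (fanoutFn_mem_FP (fanoutFn_mem_FP (const_mem_FP _) sndF_mem_FP) (comp_mem_FP onesFn_mem_FP fstF_mem_FP))))

/-- **Value of the brick** when the coded machine answers `y` within the budget `|u|`:
`budgetDecideF e ⟨u, x⟩ = y`. [folklore] -/
theorem budgetDecideF_apply {e u x y : List Bool} (h : ClockedUS.run (boolPair e x) u.length = some y) :
    budgetDecideF e (boolPair u x) = y := by
  have hU : ClockedUS.Ufn (boolPair (boolPair e x) (unaryEncodeNat u.length)) = true :: y := by
    rw [ClockedUS.Ufn_apply, h]; rfl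
  simp only [budgetDecideF, Function.comp_apply, fanoutFn_apply, sndF_boolPair, fstF_boolPair, onesFn, hU,
    dropFn_boolPair, List.length_singleton, List.drop_one, List.tail_cons]

/-! ### Downward translation -/

/-- **A language in `DTIME T` is decidable in polynomial time given a unary budget of length
`p(c · T(n) + c)`** (Arora–Barak 2009, Thm. 1.9 with §1.4.1, in the tree: `ClockedUS.sim`,
`ClockedUS.run_mono`): for `L ∈ DTIME T` there are `F ∈ FP`, `c : ℕ` and `p : ℕ[X]` with
`F ⟨u, x⟩ = [x ∈ L]` for all `u, x` with `p(c · T(|x|) + c) ≤ |u|`. This is the evaluation step of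
every machine that works on an exponential pad (the pad is the budget).
[cite: AroraBarakCC2009, Thm. 1.9 and §1.4.1] -/
theorem exists_FP_decide_of_budget {L : Language Bool} {T : ℕ → ℕ} (hL : L ∈ DTIME T) :
    ∃ F ∈ FP, ∃ (c : ℕ) (p : Polynomial ℕ), ∀ u x : List Bool,
      p.eval (c * T x.length + c) ≤ u.length → F (boolPair u x) = [L.boolIndicator x] := by
  obtain ⟨c, M, hM⟩ := hL
  refine ⟨budgetDecideF (ClockedUS.ecode M), budgetDecideF_mem_FP _, c, ClockedUA.pM M, fun u x hu => ?_⟩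
  have h1 : ClockedUS.run (boolPair (ClockedUS.ecode M) x) ((ClockedUA.pM M).eval (c * T x.length + c)) =
      some [L.boolIndicator x] := by
    have := ClockedUS.sim M (hM x)
    exact this
  exact budgetDecideF_apply (ClockedUS.run_mono hu h1)

end Literature.Computability.Complexity

end
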